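import Summits.QuantumFields.YangMills.Theorems.BalabanUVNodesN24Stub23VWShareK1AxV11
import Summits.QuantumFields.YangMills.Theorems.BalabanUVNodesK1AxV11Roads
import Summits.QuantumFields.YangMills.Theses.BalabanUVNodes

/-!
# BalabanUVNodes ∕ K1ᴬ LINE 2′ — THE THIN ROUTE-CONE READING: K1ᴬ `StabilityBRunRowsAtRecordR13SepCoPHVAx` (stmt-QuantumFields-27239) BY ITS ROUTE NAME from the per-node bills, NODE O's
# run-rows bill and the (C) bill at a witness family, THROUGH the three registered LINE-2′ texts (their signatures proved Theses-free in `…N24Stub1VWShareK1AxV11AERow` ✓p813787 ∕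
# `…N24Stub23VWShareK1AxV11` ✓p813862) composed by the kit's R1W road `K1AxV11Defs.k1R9_of_stubsVW` (✓p812918, Theses-free) — ONE `exact`; this file alone imports the route file

TRACK A (YM-PLAN §2d), node N24 (binder B2, COMPOSITE), seat `pub-ymgap-dag-n24-c` g24 (the -a hand on LINE 2′), `--kind proof --supports stmt-QuantumFields-27239 --as helper` (count-neutral).  The
ONLY file of this seat's LINE-2′ chain in the route cone (it must name the route decl; gate `lint.theses-cone` kept to this one 1-theorem module; `K1AxV11StubTexts` is NOT imported — the three
texts are read as their signatures, which `k1R9_of_stubsVW` consumes; `K1AxV11StubTexts.stabilityBRunRowsAtRecordR13SepCoPHVAx_of_stubTextsVW` IS `k1R9_of_stubsVW` by `δ`).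

WHICH CHILD BLOCKS K1ᴬ ON LINE 2′ (kernel form = this theorem's hypothesis list, BY NAME, at a witness family `Θ F i` — e.g. the K1ᴬ face's `theta13OfThm1CCMWZBAx …`, which IS on the live
re-pin): N05 `h05` (S-form `B8LeafOfRecordSubBH`) · N06 `h06` (as registered the rung does not pin N06: junk-payable by `N06AtRecord9CB10Y.exists_junkOps_b9LeafX_Y9OfRecord` — honest N06 content is
the top-pair certificate the K1 faces key) · N07 `h07` (served: dag-n07-e ✓p813512) · N08 `h08` · N09 `h09`+`h09T` · N10 `h10` · N11 `h11` · 𝐑 `hR` · N12 `h12` (served at the live re-pin: dag-n12-d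
`…N12BillH12ForStub1VWK1AxV11OfJunctionRows`) · N13 `h13` (= the ENGINE's a.e. row, ✓p811182 §2) · NODE O `hrows` · (C) `hC`.
HONEST SCOPE ∕ A6.  Implication only; every bill is a DISPLAYED hypothesis, inhabited at NO θ here (audit `proof.conditional`); nothing of Bałaban asserted; no registered stub closed; K1ᴬ OPEN
(v11.1 0∕6, never summed across lines); N24 COMPOSITE — no discharge, no count claim (discharged 8∕27 · K 1∕4 unmoved).  One finite 𝕋⁴ programme at fixed ε — NOT continuum ∕ ℝ⁴ ∕ OS; NOT the
Yang–Mills mass gap (Clay).  No `def`, no `instance`, no `sorry`.  References (bookkeeping only): [Balaban1989LargeFieldII] Thm 1 p.355, (0.1) pp.355–356; [Balaban1987RG1] Thm 3 p.264, (1.20)–(1.22)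
p.264, (5.10) p.293, §1 pp.263–264; [Balaban1988Convergent] Cor. 3 (2.50) p.264; [Balaban1989LargeFieldI] (0.2)–(0.6) p.176, Prop. 1 p.194.
-/

noncomputable section

open scoped BigOperators
open MeasureTheory

namespace Summit.QuantumFields.YangMills.BalabanUVNodes.N24K1AxByNameOfBillsLine2VW

open Literature.MathematicalPhysics.QuantumFieldTheory.Balaban1983to89
open Literature.MathematicalPhysics.QuantumFieldTheory.Balaban1983to89.Node00
open DagBinding T4Continuum FlowStepRuns
open FlowStep (RGEqH prefixOf)
open Summit.QuantumFields.YangMills.Theorems.BalabanUVNodesK2NamedJetsRunRemAt (RunConstRemainder SurvCont)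
open Summit.QuantumFields.YangMills.Theorems.K1AxV11Defs (Inhabited13)
open Summit.QuantumFields.YangMills.Theorems.K1AxV11Defs (k1R9_of_stubsVW)
open Summit.QuantumFields.YangMills.BalabanUVNodes.N24Stub1VWShareK1AxV11AERow (stub1TextVW_of_bills_atWitnessFamily_aeRow)
open Summit.QuantumFields.YangMills.BalabanUVNodes.N24Stub23VWShareK1AxV11 (stub2TextVW_of_bills_atWitnessFamily stub3TextVW_of_bills_atWitnessFamily)

/-! ## ★★★★ K1ᴬ BY ITS ROUTE NAME from the bills at a witness family, THROUGH the three registered LINE-2′ texts by name -/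

/-- **★★★★ K1ᴬ `StabilityBRunRowsAtRecordR13SepCoPHVAx` (stmt-QuantumFields-27239) BY ITS ROUTE NAME FROM THE PER-NODE BILLS, NODE O's RUN-ROWS BILL AND THE (C) BILL AT A WITNESS FAMILY —
THROUGH THE REGISTERED LINE 2′** (`stub_nodes13PWSVW` ∕ `stub_runRows13PWSVW` ∕ `stub_cont13VW`'s texts by name from above, composed by the mirror's by-name concluder `K1AxV11StubTexts.stabilityBRunRowsAtRecordR13SepCoPHVAx_of_stubTextsVW` ✓p813154 =
the kit's R1W road `k1R9_of_stubsVW` ✓p812918).  WHICH CHILD BLOCKS K1ᴬ on LINE 2′ = this hypothesis list, BY NAME, at the family.  CONDITIONAL (audit `proof.conditional` displays the bills); not a closure; no registered stub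
closed; no count moved. [cite: Balaban1989LargeFieldII, Thm 1 p.355, (0.1) pp.355–356, p.391; Balaban1988Convergent, Cor. 3 (2.50) p.264; Balaban1987RG1, Thm 3 p.264, (1.20)–(1.22) p.264, (5.10) p.293, §1 pp.263–264; Balaban1989LargeFieldI, (0.2)–(0.6) p.176, Prop. 1 p.194; Balaban1985RegularSpaces, Thm 8 p.101; Balaban1985UV3, Thm 1 p.257 (bookkeeping)] -/
theorem N24_stabilityBRunRowsAtRecordR13SepCoPHVAx_byName_of_bills_atWitnessFamily (ι : T4Family → Type) (Θ : ∀ F : T4Family, ι F → Stage13HParams F 2) (hK0 : ∀ F : T4Family, Inhabited13 F → Nonempty (ι F))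
    (hP : ∀ (F : T4Family) (i : ι F), (Θ F i).Provisos₁₃SepCoPHAx F 2) (hU : ∀ (F : T4Family) (i : ι F), (Θ F i).ZhUnity F 2 ∧ (Θ F i).SlotsNondegenerate₁₃Ax F 2)
    (hθ : ∀ (F : T4Family) (i : ι F), (Θ F i).Admissible F 2)
    (h05 : ∀ (F : T4Family) (i : ι F), ∃ lam8 : ResidB8 (Θ F i).toStage3Params, B8LeafOfRecordSubBH (Θ F i).toStage3Params lam8)
    (h06 : ∀ (F : T4Family) (_ : ι F), ∃ Y₀ : PrintedCarriers9X, B9LeafX Y₀)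
    (h07 : ∀ (F : T4Family) (_ : ι F), ∃ ζ : ResidZ F 2, B11Leaf (Z11OfRecord F 2 ζ))
    (h08 : ∀ (F : T4Family) (i : ι F), PrintedUV3V 2 (Θ F i).L)
    (h09 : ∀ (F : T4Family) (i : ι F), ∃ lam12 : ResidB12 F 2 (Θ F i).τ9.M,
      ∀ P : B12.RunParams, B12Sec2to5.Lemma4Printed (F12OfRecord₁₂ F 2 (Θ F i).toStage12Params lam12 P) (lam12 P).consts)
    (h09T : ∀ (F : T4Family) (i : ι F), ∃ γ₉ : ℝ, 0 < γ₉ ∧ ∀ w : WorldP, w.C = (datumOfRecord₁₃SepCoPHAx F 2 (Θ F i) (hP F i)).C → w.γ ≤ γ₉ →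
      ∀ P : B12.RunParams, (leavesP w P).smallCouplings → (leavesP w P).smallFieldInductive)
    (h10 : ∀ (F : T4Family) (i : ι F), ∃ lam13 : B12.RunParams → ResidB13 (Θ F i).toStage3Params, ∀ P : B12.RunParams, B13LeafOfRecord (Θ F i).toStage3Params (lam13 P))
    (h11 : ∀ (F : T4Family) (i : ι F), ∀ βup β₀ : ℝ, ∃ γ₁₁ : ℝ, 0 < γ₁₁ ∧ ∀ w : WorldP, w.C = (datumOfRecord₁₃SepCoPHAx F 2 (Θ F i) (hP F i)).C → w.βup = βup → w.β₀ = β₀ → w.γ ≤ γ₁₁ →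
      ∀ P : B12.RunParams, (leavesP w P).b7 → (leavesP w P).b8 → (leavesP w P).b9 → (leavesP w P).b10 → (leavesP w P).b11 →
        (leavesP w P).smallCouplings → (leavesP w P).smallFieldInductive → (leavesP w P).flowControl →
          ∀ k, k < P.K → SLaw₁₃CoPHChi F 2 (Θ F i) (chiβOfRecord₁₃Ax F 2 (Θ F i).toStage13Params) P k → TLaw₁₃CoPHChi F 2 (Θ F i) (chiβOfRecord₁₃Ax F 2 (Θ F i).toStage13Params) P k)
    (hR : ∀ (F : T4Family) (i : ι F) (P : B12.RunParams) (k : ℕ), k < P.K →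
      TLaw₁₃CoPHChi F 2 (Θ F i) (chiβOfRecord₁₃Ax F 2 (Θ F i).toStage13Params) P k → SLaw₁₃CoPHChi F 2 (Θ F i) (chiβOfRecord₁₃Ax F 2 (Θ F i).toStage13Params) P (k + 1))
    (h12 : ∀ (F : T4Family) (i : ι F), ∃ (lamW : ResidW F 2) (γ₁₂ : ℝ), 0 < γ₁₂ ∧ (∀ P : B12.RunParams, 1 ≤ P.K → lamW.kSel P < P.K) ∧
      ∀ P : B12.RunParams, lamW.kSel P < P.K → Step.InInterval γ₁₂ P.K (gOfRecord₁₃Ax F 2 (Θ F i).toStage13Params P) → B15Leaf (WOfRecord₁₃Ax F 2 (Θ F i).toStage13Params lamW P))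
    (h13 : ∀ (F : T4Family) (i : ι F), ∃ γ₁₃ : ℝ, 0 < γ₁₃ ∧ ∃ em ep : ℝ → ℝ,
        (∀ P : B12.RunParams, ((datumOfRecord₁₃SepCoPHAx F 2 (Θ F i) (hP F i)).C P).flow.InInterval γ₁₃ P.K → SLaw₁₃CoPHChi F 2 (Θ F i) (chiβOfRecord₁₃Ax F 2 (Θ F i).toStage13Params) P 0 →
      ∀ U : GaugeField (F.P P.K) 0 (SU 2),
        chiβOfRecord₁₃Ax F 2 (Θ F i).toStage13Params P.K (gOfRecord₁₃Ax F 2 (Θ F i).toStage13Params P) 0 U *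
              Real.exp (-(1 / (gOfRecord₁₃Ax F 2 (Θ F i).toStage13Params P 0) ^ 2 * wilsonBGOfRecord F 2 (Θ F i).εbg P 0 U)
                - em (gOfRecord₁₃Ax F 2 (Θ F i).toStage13Params P 0) * (Fintype.card (Site (F.P P.K) 0) : ℝ)) ≤ densOfRecord₁₃Chi F 2 (Θ F i).toStage13Params (chiβOfRecord₁₃Ax F 2 (Θ F i).toStage13Params) P 0 U ∧
          densOfRecord₁₃Chi F 2 (Θ F i).toStage13Params (chiβOfRecord₁₃Ax F 2 (Θ F i).toStage13Params) P 0 U ≤ Real.exp (ep (gOfRecord₁₃Ax F 2 (Θ F i).toStage13Params P 0) * (Fintype.card (Site (F.P P.K) 0) : ℝ))) ∧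
        (∀ P : B12.RunParams, ((datumOfRecord₁₃SepCoPHAx F 2 (Θ F i) (hP F i)).C P).flow.InInterval γ₁₃ P.K → ∀ k, k + 1 ≤ P.K → SLaw₁₃CoPHChi F 2 (Θ F i) (chiβOfRecord₁₃Ax F 2 (Θ F i).toStage13Params) P (k + 1) →
      ∀ᵐ U ∂(fieldMeasure (F.P P.K) (k + 1) (SU 2)),
        chiβOfRecord₁₃Ax F 2 (Θ F i).toStage13Params P.K (gOfRecord₁₃Ax F 2 (Θ F i).toStage13Params P) (k + 1) U *
              Real.exp (-(1 / (gOfRecord₁₃Ax F 2 (Θ F i).toStage13Params P (k + 1)) ^ 2 * wilsonBGOfRecord F 2 (Θ F i).εbg P (k + 1) U)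
                - em (gOfRecord₁₃Ax F 2 (Θ F i).toStage13Params P (k + 1)) * (Fintype.card (Site (F.P P.K) (k + 1)) : ℝ)) ≤ densOfRecord₁₃Chi F 2 (Θ F i).toStage13Params (chiβOfRecord₁₃Ax F 2 (Θ F i).toStage13Params) P (k + 1) U ∧
          densOfRecord₁₃Chi F 2 (Θ F i).toStage13Params (chiβOfRecord₁₃Ax F 2 (Θ F i).toStage13Params) P (k + 1) U ≤ Real.exp (ep (gOfRecord₁₃Ax F 2 (Θ F i).toStage13Params P (k + 1)) * (Fintype.card (Site (F.P P.K) (k + 1)) : ℝ))))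
    (hrows : ∀ (F : T4Family) (i : ι F), ∃ (b : ℕ → ℝ) (r γ₀ B M : ℝ), 0 < γ₀ ∧ RunConstRemainder (betaOfRecord₁₃Ax F 2 (Θ F i).toStage13Params) b r γ₀ ∧ (∀ k, b k ≤ B) ∧
      ∀ (n : ℕ) (gs : ℕ → ℝ), RGEqH n (betaOfRecord₁₃Ax F 2 (Θ F i).toStage13Params) gs → Step.InInterval γ₀ n gs →
        ∀ k, k ≤ n → -M ≤ ∑ j ∈ Finset.Ico k n, betaOfRecord₁₃Ax F 2 (Θ F i).toStage13Params j (prefixOf gs j))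
    (hC : ∀ (F : T4Family) (i : ι F), ∃ γc : ℝ, 0 < γc ∧ ∀ γ₀ : ℝ, 0 < γ₀ → γ₀ ≤ γc → SurvCont (betaOfRecord₁₃Ax F 2 (Θ F i).toStage13Params) γ₀)
    :
    Summit.QuantumFields.YangMills.Theses.BalabanUVNodes.StabilityBRunRowsAtRecordR13SepCoPHVAx :=
  k1R9_of_stubsVW (stub1TextVW_of_bills_atWitnessFamily_aeRow ι Θ hK0 hP hU hθ h05 h06 h07 h08 h09 h09T h10 h11 hR h12 h13 0)
    (stub2TextVW_of_bills_atWitnessFamily ι Θ hK0 hP hU hθ h05 h06 h07 h08 h09 h09T h10 h11 hR h12 h13 hrows)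
    (stub3TextVW_of_bills_atWitnessFamily ι Θ hK0 hP hU hθ h05 h06 h07 h08 h09 h09T h10 h11 hR h12 h13 hrows hC)

end Summit.QuantumFields.YangMills.BalabanUVNodes.N24K1AxByNameOfBillsLine2VW

end
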